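import Summits.ResolutionOfSingularities.ResolutionOfSingularities.Theorems.HilbertSamuelEliminationSigmaMaxModificationsCorridor3HypersurfaceOrder
import Literature.AlgebraicGeometry.Resolution.BlowupChartMembership
import Literature.AlgebraicGeometry.Resolution.AlterationsSectionDivisor
import Literature.AlgebraicGeometry.Resolution.NormalCrossingsStrictification
import Literature.AlgebraicGeometry.Resolution.HilbertSamuelLocal
import Mathlib.AlgebraicGeometry.Morphisms.ClosedImmersion
import Mathlib.RingTheory.Filtration
import HarnessLib

/-!
# Route `HilbertSamuelElimination`, crux `SigmaMaxModificationsCorridor3`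
# (stmt-ResolutionOfSingularities-19249; child of `SigmaMaxModifications` stmt-…-18506),
# line `tame_wild` v3 (confined form) — brick **T4: the chart dictionary**

[OURS · L1 W4.2] Brick T4 of the lead's helpers-v3 (maximal form), consumed by the landed assembly
`confinedNu3_of_bricks_max` (p481325): for a chart of `Y` given by an open immersion `j : V → Y`
(`Y` reduced, locally of finite type over a field, `dim Y ≤ 3`) and a closed immersion `ι : V → Z`
with kernel ideal sheaf `I`, `Z` regular of dimension `≤ 4`, `I ≠ 0` effective Cartier, and a
hypersurface value `ν = hypersurfaceHF m` (`m ≥ 1`) MAXIMAL in `Σ_Y(3)`: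
the support of the marked ideal `(Z, I, ∅, m)` is exactly `ι(V(ν))`, and `ord_z I ≤ m` at every
point of `Z`. Pointwise this is the landed `Helpers.idealOrder_le_and_mem_support_iff_of_maximal`
(p466037, Bennett at every level p465246); the inputs assembled here are the stalk isomorphisms
`𝒪_{V,v} ≃ 𝒪_{Z,ι v}/I_{ι v}` of the closed immersion (`stalkIdeal_ker_eq_ker_stalkMap`, surjectivity
on stalks), local generators of the effective Cartier `I` (`IsEffectiveCartier.exists_stalkIdeal_eq_span`),
finiteness of their orders (Krull's intersection theorem), `dim 𝒪_{Z,z} ≤ dim Z ≤ 4`, and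
`supp(I) = ι(V)` (`Scheme.Hom.support_ker`). NOT a statement of any manuscript.

## Sources

* V. Cossart, U. Jannsen, S. Saito, LNM 2270 (2020), Thm. 2.3, Lemma 2.23, Def. 2.28.
  [CossartJannsenSaito2020]
* E. Bierstone, D. Grigoriev, P. Milman, J. Włodarczyk, arXiv:1206.3090, Def. 3.1.2.
  [BierstoneGrigorievMilmanWlodarczyk2011]
-/

set_option linter.dupNamespace false -- mandated namespace of this single-conjunct summit

noncomputable section

open CategoryTheory AlgebraicGeometry TopologicalSpace Topology IsLocalRing
open Literature.AlgebraicGeometry.Resolution Literature.RingTheory.HilbertSamuel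
open Summit.ResolutionOfSingularities.ResolutionOfSingularities.Theorems.SigmaMaxModificationsCorridor3.TameWild

namespace Summit.ResolutionOfSingularities.ResolutionOfSingularities.Theorems.SigmaMaxModificationsCorridor3.Helpers

/-- In a local ring, a principal stalk ideal not contained in the maximal ideal has order `0`:
`ord_z I < 1`. [folklore] -/
theorem idealOrder_eq_zero_of_not_mem_support {Z : Scheme.{0}} (I : Z.IdealSheafData) {z : Z}
    (hz : z ∉ I.support) : idealOrder I z = 0 := by
  have h1 : ¬ ((1 : ℕ) : ℕ∞) ≤ idealOrder I z := by
    intro h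
    apply hz
    rw [mem_support_iff_stalkIdeal_le, ← pow_one (maximalIdeal _)]
    exact (le_idealOrder_iff I z 1).mp h
  simpa using h1

/-- **Brick T4 — the chart dictionary (maximal form).** The hypotheses `dim Y ≤ 3` and `I ≠ 0` of
the typed signature are not needed and kept only to match it. [cite: CossartJannsenSaito2020, Thm. 2.3, Lemma 2.23]
[cite: BierstoneGrigorievMilmanWlodarczyk2011, Def. 3.1.2] -/
theorem stub_T4_chartDictionary (k : Type) [Field k] (Y : Scheme.{0}) (g : Y ⟶ Spec (.of k))
    [LocallyOfFiniteType g] [IsReduced Y] (_hY : topologicalKrullDim Y ≤ ((3 : ℕ) : WithBot ℕ∞))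
    (ν : ℕ → ℕ) (m : ℕ) (hm : 1 ≤ m) (hνm : ν = hypersurfaceHF m)
    (hν : Maximal (· ∈ Scheme.hsValues Y 3) ν)
    (V : Scheme.{0}) (j : V ⟶ Y) [IsOpenImmersion j] (Z : Scheme.{0}) (hZ : Scheme.IsRegular Z)
    (hdimZ : topologicalKrullDim Z ≤ ((4 : ℕ) : WithBot ℕ∞)) (I : Z.IdealSheafData) (_hI0 : I ≠ ⊥)
    (hI : IsEffectiveCartier I) (ι : V ⟶ Z) [IsClosedImmersion ι] (hιI : ι.ker = I) :
    (⟨I, [], m⟩ : MarkedIdeal Z).support = ι.base '' Scheme.hsStratum V 3 ν ∧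
      ∀ z : Z, idealOrder I z ≤ (m : ℕ∞) := by
  haveI : IsLocallyNoetherian Y := LocallyOfFiniteType.isLocallyNoetherian g
  haveI : IsLocallyNoetherian V := isLocallyNoetherian_of_isOpenImmersion j
  subst hνm
  have hν' : Maximal (· ∈ Scheme.hsValues Y 3) (hypersurfaceHFe (3 + 1) m) := by
    rw [show (3 + 1 : ℕ) = 4 from rfl, hypersurfaceHFe_four]
    exact hν
  -- `supp(I) = ι(V)`
  have hsuppI : (I.support : Set Z) = Set.range ι.base := by
    rw [← hιI, Scheme.Hom.support_ker, ι.isClosedEmbedding.isClosed_range.closure_eq]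
  -- the pointwise dictionary at `z = ι v`
  have key : ∀ v : V, idealOrder I (ι.base v) ≤ (m : ℕ∞) ∧
      (ι.base v ∈ (⟨I, [], m⟩ : MarkedIdeal Z).support ↔
        v ∈ Scheme.hsStratum V 3 (hypersurfaceHF m)) := by
    intro v
    haveI : IsRegularLocalRing (Z.presheaf.stalk (ι.base v)) := hZ _
    obtain ⟨e, he⟩ : ∃ e : ℕ, ringKrullDim (Z.presheaf.stalk (ι.base v)) = e :=
      exists_nat_eq_of_ne_bot_of_ne_top ringKrullDim_ne_bot ringKrullDim_ne_top
    have he4 : e ≤ 3 + 1 := by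
      have h := (ringKrullDim_stalk_le_topologicalKrullDim Z (ι.base v)).trans hdimZ
      rw [he] at h
      exact_mod_cast h
    obtain ⟨t, ht0, hIt⟩ := hI.exists_stalkIdeal_eq_span (ι.base v)
    have hzsupp : ι.base v ∈ I.support := by
      rw [← SetLike.mem_coe, hsuppI]
      exact ⟨v, rfl⟩
    have hle : ∀ i : ℕ, ((i : ℕ) : ℕ∞) ≤ idealOrder I (ι.base v) ↔
        t ∈ maximalIdeal (Z.presheaf.stalk (ι.base v)) ^ i := fun i => by
      rw [le_idealOrder_iff, hIt, Ideal.span_singleton_le_iff_mem]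
    have htm : t ∈ maximalIdeal (Z.presheaf.stalk (ι.base v)) := by
      have h := (mem_support_iff_stalkIdeal_le I (ι.base v)).mp hzsupp
      rw [hIt, Ideal.span_singleton_le_iff_mem] at h
      exact h
    -- the order `m'` of `t` is finite (Krull's intersection theorem) and `≥ 1`
    obtain ⟨m', hm'⟩ : ∃ m' : ℕ, idealOrder I (ι.base v) = m' := by
      have hne : idealOrder I (ι.base v) ≠ ⊤ := by
        intro htop
        have hall : ∀ i : ℕ, t ∈ maximalIdeal (Z.presheaf.stalk (ι.base v)) ^ i := fun i =>
          (hle i).mp (by rw [htop]; exact le_top)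
        have hmem : t ∈ (⨅ i : ℕ, maximalIdeal (Z.presheaf.stalk (ι.base v)) ^ i) :=
          Ideal.mem_iInf.mpr hall
        rw [Ideal.iInf_pow_eq_bot_of_isLocalRing _ (maximalIdeal.isMaximal _).ne_top] at hmem
        exact nonZeroDivisors.ne_zero ht0 hmem
      exact ⟨(idealOrder I (ι.base v)).toNat, (ENat.coe_toNat hne).symm⟩
    have hm'1 : 1 ≤ m' := by
      have h := (hle 1).mpr (by rw [pow_one]; exact htm)
      rw [hm'] at h
      exact_mod_cast h
    have hgm : t ∈ maximalIdeal (Z.presheaf.stalk (ι.base v)) ^ m' :=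
      (hle m').mp (by rw [hm'])
    have hgm' : t ∉ maximalIdeal (Z.presheaf.stalk (ι.base v)) ^ (m' + 1) := by
      intro h
      have h2 := (hle (m' + 1)).mpr h
      rw [hm'] at h2
      exact absurd (by exact_mod_cast h2 : m' + 1 ≤ m') (by omega)
    -- the stalk isomorphism `𝒪_{Y, j v} ≃ 𝒪_{Z, ι v} / (t)`
    have hker : RingHom.ker (ι.stalkMap v).hom = Ideal.span {t} := by
      rw [← stalkIdeal_ker_eq_ker_stalkMap ι v, hιI, hIt]
    have hsurj : Function.Surjective (ι.stalkMap v).hom := ι.stalkMap_surjective v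
    let εV : V.presheaf.stalk v ≃+* Z.presheaf.stalk (ι.base v) ⧸ Ideal.span {t} :=
      ((Ideal.quotEquivOfEq hker.symm).trans (RingHom.quotientKerEquivOfSurjective hsurj)).symm
    let ε : Y.presheaf.stalk (j.base v) ≃+* Z.presheaf.stalk (ι.base v) ⧸ Ideal.span {t} :=
      (asIso (j.stalkMap v)).commRingCatIsoToRingEquiv.trans εV
    obtain ⟨hord, hiff⟩ := idealOrder_le_and_mem_support_iff_of_maximal hν'
      (⟨I, [], m⟩ : MarkedIdeal Z) rfl he he4 hm'1 hIt hgm hgm' ε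
    refine ⟨hord, hiff.trans ?_⟩
    rw [Scheme.mem_hsStratum_iff, Scheme.mem_hsStratum_iff, Scheme.hsFun_eq_of_isOpenImmersion j 3 v,
      show (3 + 1 : ℕ) = 4 from rfl, hypersurfaceHFe_four]
  refine ⟨?_, fun z => ?_⟩
  · -- `supp(Z, I, ∅, m) = ι(V(ν))`
    ext z
    constructor
    · intro hz
      have hz1 : ((1 : ℕ) : ℕ∞) ≤ idealOrder I z :=
        le_trans (by exact_mod_cast hm) (show ((m : ℕ) : ℕ∞) ≤ idealOrder I z from hz)
      have hzs : z ∈ (I.support : Set Z) := by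
        rw [SetLike.mem_coe, mem_support_iff_stalkIdeal_le, ← pow_one (maximalIdeal _)]
        exact (le_idealOrder_iff I z 1).mp hz1
      rw [hsuppI] at hzs
      obtain ⟨v, rfl⟩ := hzs
      exact ⟨v, (key v).2.mp hz, rfl⟩
    · rintro ⟨v, hv, rfl⟩
      exact (key v).2.mpr hv
  · -- `ord_z I ≤ m` everywhere
    by_cases hz : z ∈ Set.range ι.base
    · obtain ⟨v, rfl⟩ := hz
      exact (key v).1
    · have hz' : z ∉ I.support := by
        rw [← SetLike.mem_coe, hsuppI]
        exact hz
      rw [idealOrder_eq_zero_of_not_mem_support I hz']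
      exact zero_le

end Summit.ResolutionOfSingularities.ResolutionOfSingularities.Theorems.SigmaMaxModificationsCorridor3.Helpers

end
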